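import Summits.KontsevichZagierPeriods.KontsevichZagierPeriods.Theorems.SoloInformedTameCircleSquaring
import Summits.KontsevichZagierPeriods.KontsevichZagierPeriods.Theorems.SoloInformedTameMapVolume
import HarnessLib

/-!
# SoloInformed — no tame NONLINEAR circle squaring (COROLLARY SQ, nonlinear kernel form)

Solo programme `solo-KontsevichZagierPeriods-informed`, session s138, fourth and last file of the
NONLINEAR form of COROLLARY SQ of the `KZ_ℝ` method barrier (VERDICT §4).  File
`SoloInformedTameCircleSquaring` proved: a `ℚ`-semialgebraic set exactly dissected into
`ℝ`-semialgebraic pieces which EQUI-AFFINE maps `x ↦ M x + b` (`det M = ±1`, real entries)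
reassemble into a box has ALGEBRAIC volume; hence the disc admits no such dissection (Lindemann).
Here the maps are ARBITRARY:

* `soloInformed_isAlgebraic_volume_of_tameMapEquidecomp` — **THEOREM.** Let `D₀ ⊆ ℝⁿ` be
  `ℚ`-semialgebraic, exactly partitioned into finitely many `ℝ`-semialgebraic pieces `A i` (any
  dimensions).  Let maps `f i` be given whose graphs over `A i` are `ℝ`-semialgebraic, which are
  injective on `A i`, and which at every point of `A i` have a derivative WITHIN `A i` of
  determinant `±1` (e.g. the restriction of any volume-preserving semialgebraic `C¹` map:
  isometries, equi-affine maps, polynomial shears `(x, y) ↦ (x, y + x²)`, …).  If the images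
  `f i '' A i` exactly partition a box `∏_j [0, a_j]` with real sides, then `vol(D₀)` is an
  algebraic number.
* `soloInformed_no_tame_circle_squaring_nonlinear` — **COROLLARY.** The closed unit disc admits no
  such nonlinear tame dissection onto any box: `vol = π` is transcendental.

Proof.  Pieces AND graphs are fibres of `ℚ`-semialgebraic families at real vectors
(`soloInformed_isSemialgebraic_real_iff_fibre`, transported to the index `Fin n ⊕ Fin n` for the
graphs); all real data are ONE real parameter `p₀` of the universal nonlinear shape
`soloInformedTameMapShapeOf`; validity (`SoloInformedTameMapShape.Valid`: partition, functional
graphs, bijection onto the box, and the first-order `ε–δ` differentiability clause with Jacobian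
`±1`) holds at `p₀` — the differentiability clause is read off `HasFDerivWithinAt` through the
matrix of the derivative (`soloInformed_taylor_clmEntry`); validity is `ℚ`-semialgebraic
(`isSemialgebraic_setOf_valid`) and sound (`aeval_prod_side_eq_volume_of_valid`, the change of
variables formula); `soloInformed_realParameter_barrier_core_fintype` concludes.

References: Tarski (1925); Dubins–Hirsch–Karush (1963); Laczkovich (1990); Bochnak–Coste–Roy
(1998) §2.2, §5; Evans–Gariepy (1992) §3.3; Lindemann (1882).
-/

noncomputable section

namespace Summit.KontsevichZagierPeriods.KontsevichZagierPeriods.Theorems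

open Set MvPolynomial MeasureTheory Filter Topology Literature.ModelTheory.ExponentialFields
  Literature.NumberTheory.Transcendental

section Calculus

variable {n : ℕ}

/-- The `(j, k)` entry of the matrix of a continuous linear endomorphism of `ℝⁿ`. [folklore] -/
def soloInformedCLMEntry (L : (Fin n → ℝ) →L[ℝ] (Fin n → ℝ)) (q : Fin n × Fin n) : ℝ :=
  LinearMap.toMatrix' (L : (Fin n → ℝ) →ₗ[ℝ] (Fin n → ℝ)) q.1 q.2

/-- The matrix of entries has the determinant of the map. [folklore] -/
theorem soloInformed_det_of_clmEntry (L : (Fin n → ℝ) →L[ℝ] (Fin n → ℝ)) :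
    (Matrix.of fun j k => soloInformedCLMEntry L (j, k)).det = L.det := by
  have hM : (Matrix.of fun j k => soloInformedCLMEntry L (j, k)) =
      LinearMap.toMatrix' (L : (Fin n → ℝ) →ₗ[ℝ] (Fin n → ℝ)) := by
    ext j k
    rfl
  rw [hM]
  simp [ContinuousLinearMap.det]

/-- Coordinates of `L v` through the entries. [folklore] -/
theorem soloInformed_clm_apply_eq_sum_clmEntry (L : (Fin n → ℝ) →L[ℝ] (Fin n → ℝ))
    (v : Fin n → ℝ) (j : Fin n) : L v j = ∑ k, soloInformedCLMEntry L (j, k) * v k := by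
  have h := congr_fun (LinearMap.toMatrix'_mulVec (L : (Fin n → ℝ) →ₗ[ℝ] (Fin n → ℝ)) v) j
  simp only [Matrix.mulVec, dotProduct, ContinuousLinearMap.coe_coe] at h
  exact h.symm

/-- **From a derivative within the set to the coordinatewise first-order Taylor clause** (the
converse of `soloInformed_hasFDerivWithinAt_of_taylor`). [folklore] -/
theorem soloInformed_taylor_clmEntry {A : Set (Fin n → ℝ)} {g : (Fin n → ℝ) → Fin n → ℝ}
    {x : Fin n → ℝ} {L : (Fin n → ℝ) →L[ℝ] (Fin n → ℝ)} (hg : HasFDerivWithinAt g L A x)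
    {e : ℝ} (he : 0 < e) :
    ∃ d : ℝ, 0 < d ∧ ∀ x' ∈ A, (∀ k, x' k - x k < d ∧ x k - x' k < d) →
      ∀ j, (g x' j - g x j - ∑ k, soloInformedCLMEntry L (j, k) * (x' k - x k)) ^ 2 ≤
        e ^ 2 * ∑ k, (x' k - x k) ^ 2 := by
  have H := (Asymptotics.isLittleO_iff.1 (hasFDerivWithinAt_iff_isLittleO.1 hg)) he
  rw [eventually_nhdsWithin_iff, Metric.eventually_nhds_iff] at H
  obtain ⟨d, hd, H⟩ := H
  refine ⟨d, hd, fun x' hx' hcl j => ?_⟩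
  have hdist : dist x' x < d := (dist_pi_lt_iff hd).2 fun k => by
    rw [Real.dist_eq]
    exact abs_sub_lt_iff.2 (hcl k)
  have hn : ‖g x' - g x - L (x' - x)‖ ≤ e * ‖x' - x‖ := H hdist hx'
  have hcoord : (g x' - g x - L (x' - x)) j =
      g x' j - g x j - ∑ k, soloInformedCLMEntry L (j, k) * (x' k - x k) := by
    simp only [Pi.sub_apply, soloInformed_clm_apply_eq_sum_clmEntry L (x' - x) j]
  have hj : |g x' j - g x j - ∑ k, soloInformedCLMEntry L (j, k) * (x' k - x k)| ≤
      e * ‖x' - x‖ := by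
    rw [← hcoord, ← Real.norm_eq_abs]
    exact (norm_le_pi_norm _ j).trans hn
  have hsum : ‖x' - x‖ ^ 2 ≤ ∑ k, (x' k - x k) ^ 2 := by
    simpa only [Pi.sub_apply] using soloInformed_norm_sq_le_sum_sq (x' - x)
  calc (g x' j - g x j - ∑ k, soloInformedCLMEntry L (j, k) * (x' k - x k)) ^ 2
      ≤ (e * ‖x' - x‖) ^ 2 := by
        rw [← sq_abs]
        exact pow_le_pow_left₀ (abs_nonneg _) hj 2
    _ = e ^ 2 * ‖x' - x‖ ^ 2 := mul_pow _ _ _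
    _ ≤ e ^ 2 * ∑ k, (x' k - x k) ^ 2 := mul_le_mul_of_nonneg_left hsum (sq_nonneg _)

/-- `ℝ`-semialgebraic subsets of `ℝ^{n ⊔ n}` (index `Fin n ⊕ Fin n`) are fibres of
`ℚ`-semialgebraic families at real vectors (transport of
`soloInformed_isSemialgebraic_real_iff_fibre` along `finSumFinEquiv`).
[cite: BochnakCosteRoy1998, §2.2] -/
theorem soloInformed_exists_fibre_of_isSemialgebraic_sum {T : Set (Fin n ⊕ Fin n → ℝ)}
    (hT : IsSemialgebraic ℝ T) :
    ∃ (m : ℕ) (c : Fin m → ℝ) (S : Set (Fin m ⊕ Fin (n + n) → ℝ)), IsSemialgebraic ℚ S ∧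
      ∀ w : Fin n ⊕ Fin n → ℝ, w ∈ T ↔ Sum.elim c (w ∘ ⇑finSumFinEquiv.symm) ∈ S := by
  have hT₁ : IsSemialgebraic ℝ ((fun v : Fin (n + n) → ℝ => v ∘ ⇑finSumFinEquiv) ⁻¹' T) :=
    hT.preimage_comp _
  obtain ⟨m, c, S, hS, hTS⟩ := soloInformed_isSemialgebraic_real_iff_fibre.1 hT₁
  refine ⟨m, c, S, hS, fun w => ?_⟩
  have hw : (w ∘ ⇑finSumFinEquiv.symm) ∘ ⇑(finSumFinEquiv : Fin n ⊕ Fin n ≃ Fin (n + n)) = w := by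
    funext t
    simp only [Function.comp_apply, Equiv.symm_apply_apply]
  have h1 : w ∈ T ↔
      w ∘ ⇑finSumFinEquiv.symm ∈ (fun v : Fin (n + n) → ℝ => v ∘ ⇑finSumFinEquiv) ⁻¹' T := by
    rw [mem_preimage, hw]
  rw [h1, hTS, mem_setOf_eq]

end Calculus

section UniversalMapShape

variable {n N : ℕ} (m m' : Fin N → ℕ)

/-- The real-parameter index of the universal nonlinear shape: fibre parameters of the pieces,
fibre parameters of the graphs, box sides. [folklore] -/
abbrev SoloInformedTameMapIdx (n N : ℕ) (m m' : Fin N → ℕ) : Type :=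
  (Σ i : Fin N, Fin (m i)) ⊕ ((Σ i : Fin N, Fin (m' i)) ⊕ Fin n)

/-- The real parameter collecting all real data of a nonlinear dissection. [folklore] -/
def soloInformedTameMapParam (c : ∀ i : Fin N, Fin (m i) → ℝ) (c' : ∀ i : Fin N, Fin (m' i) → ℝ)
    (a : Fin n → ℝ) : SoloInformedTameMapIdx n N m m' → ℝ :=
  Sum.elim (fun u => c u.1 u.2) (Sum.elim (fun u => c' u.1 u.2) a)

/-- The re-indexing of the `i`-th piece family. [folklore] -/
def soloInformedTameMapEmbS (i : Fin N) :
    Fin (m i) ⊕ Fin n → SoloInformedTameMapIdx n N m m' ⊕ Fin n :=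
  Sum.map (fun u => Sum.inl ⟨i, u⟩) id

/-- The re-indexing of the `i`-th graph family. [folklore] -/
def soloInformedTameMapEmbG (i : Fin N) :
    Fin (m' i) ⊕ Fin (n + n) → SoloInformedTameMapIdx n N m m' ⊕ (Fin n ⊕ Fin n) :=
  Sum.map (fun u => Sum.inr (Sum.inl ⟨i, u⟩)) fun t => finSumFinEquiv.symm t

/-- **The universal nonlinear shape**: pieces and graphs = the given `ℚ`-semialgebraic families
re-indexed, box sides = coordinate variables. [folklore] -/
def soloInformedTameMapShapeOf (S : ∀ i : Fin N, Set (Fin (m i) ⊕ Fin n → ℝ))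
    (S' : ∀ i : Fin N, Set (Fin (m' i) ⊕ Fin (n + n) → ℝ)) :
    SoloInformedTameMapShape (SoloInformedTameMapIdx n N m m') n N where
  S := fun i => (fun v => v ∘ soloInformedTameMapEmbS m m' i) ⁻¹' S i
  G := fun i => (fun v => v ∘ soloInformedTameMapEmbG m m' i) ⁻¹' S' i
  Pa := fun j => X (Sum.inr (Sum.inr j))

variable {m m'} (S : ∀ i : Fin N, Set (Fin (m i) ⊕ Fin n → ℝ))
  (S' : ∀ i : Fin N, Set (Fin (m' i) ⊕ Fin (n + n) → ℝ)) (c : ∀ i : Fin N, Fin (m i) → ℝ)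
  (c' : ∀ i : Fin N, Fin (m' i) → ℝ) (a : Fin n → ℝ)

/-- The piece families of the universal nonlinear shape are `ℚ`-semialgebraic.
[cite: BochnakCosteRoy1998, §2.2] -/
theorem soloInformedTameMapShapeOf_isSemialgebraic_S (hS : ∀ i, IsSemialgebraic ℚ (S i))
    (i : Fin N) : IsSemialgebraic ℚ ((soloInformedTameMapShapeOf m m' S S').S i) :=
  (hS i).preimage_comp (soloInformedTameMapEmbS m m' i)

/-- The graph families of the universal nonlinear shape are `ℚ`-semialgebraic.
[cite: BochnakCosteRoy1998, §2.2] -/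
theorem soloInformedTameMapShapeOf_isSemialgebraic_G (hS' : ∀ i, IsSemialgebraic ℚ (S' i))
    (i : Fin N) : IsSemialgebraic ℚ ((soloInformedTameMapShapeOf m m' S S').G i) :=
  (hS' i).preimage_comp (soloInformedTameMapEmbG m m' i)

/-- The pieces of the universal nonlinear shape at the collected parameter. [folklore] -/
theorem soloInformedTameMapShapeOf_piece (i : Fin N) :
    (soloInformedTameMapShapeOf m m' S S').piece i (soloInformedTameMapParam m m' c c' a) =
      {x | Sum.elim (c i) x ∈ S i} := by
  ext x
  have h : Sum.elim (soloInformedTameMapParam m m' c c' a) x ∘ soloInformedTameMapEmbS m m' i =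
      Sum.elim (c i) x := by
    funext t
    cases t with
    | inl u => rfl
    | inr s => rfl
  simp only [SoloInformedTameMapShape.piece, soloInformedTameMapShapeOf, mem_setOf_eq,
    mem_preimage, h]

/-- The moving relations of the universal nonlinear shape at the collected parameter.
[folklore] -/
theorem soloInformedTameMapShapeOf_rel (i : Fin N) (x y : Fin n → ℝ) :
    (soloInformedTameMapShapeOf m m' S S').rel i (soloInformedTameMapParam m m' c c' a) x y ↔
      Sum.elim (c' i) (Sum.elim x y ∘ ⇑finSumFinEquiv.symm) ∈ S' i := by
  have h : Sum.elim (soloInformedTameMapParam m m' c c' a) (Sum.elim x y) ∘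
      soloInformedTameMapEmbG m m' i = Sum.elim (c' i) (Sum.elim x y ∘ ⇑finSumFinEquiv.symm) := by
    funext t
    cases t with
    | inl u => rfl
    | inr s => rfl
  simp only [SoloInformedTameMapShape.rel, soloInformedTameMapShapeOf, mem_preimage, h]

/-- The box sides of the universal nonlinear shape at the collected parameter. [folklore] -/
theorem soloInformedTameMapShapeOf_side :
    (soloInformedTameMapShapeOf m m' S S').side (soloInformedTameMapParam m m' c c' a) = a := by
  funext j
  simp only [SoloInformedTameMapShape.side, soloInformedTameMapShapeOf, aeval_X,
    soloInformedTameMapParam, Sum.elim_inr]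

end UniversalMapShape

/-- **THEOREM (nonlinear tame equidecompositions compute only algebraic volumes).** Let
`D₀ ⊆ ℝⁿ` be `ℚ`-semialgebraic, exactly partitioned into finitely many `ℝ`-semialgebraic pieces
`A i`; let maps `f i` be given with `ℝ`-semialgebraic graphs over `A i`, injective on `A i`, having
at every point of `A i` a derivative within `A i` of determinant `±1`; suppose the images
`f i '' A i` exactly partition the box `∏_j [0, a_j]` (`a_j ≥ 0` real).  Then `vol(D₀)` is an
algebraic number. [cite: BochnakCosteRoy1998, §5.2] -/
theorem soloInformed_isAlgebraic_volume_of_tameMapEquidecomp {n N : ℕ} {D₀ : Set (Fin n → ℝ)}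
    (hD₀ : IsSemialgebraic ℚ D₀) {A : Fin N → Set (Fin n → ℝ)} (hA : ∀ i, IsSemialgebraic ℝ (A i))
    (f : Fin N → (Fin n → ℝ) → Fin n → ℝ)
    (hf : ∀ i, IsSemialgebraic ℝ
      {v : Fin n ⊕ Fin n → ℝ | v ∘ Sum.inl ∈ A i ∧ f i (v ∘ Sum.inl) = v ∘ Sum.inr})
    (hinj : ∀ i, InjOn (f i) (A i)) {f' : Fin N → (Fin n → ℝ) → (Fin n → ℝ) →L[ℝ] (Fin n → ℝ)}
    (hf' : ∀ i, ∀ x ∈ A i, HasFDerivWithinAt (f i) (f' i x) (A i) x)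
    (hdet : ∀ i, ∀ x ∈ A i, (f' i x).det ^ 2 = 1) {a : Fin n → ℝ} (ha : ∀ j, 0 ≤ a j)
    (hcover : ⋃ i, A i = D₀) (hdisj : Pairwise (Function.onFun Disjoint A))
    (hcover' : ⋃ i, f i '' A i = Set.pi Set.univ fun j => Set.Icc 0 (a j))
    (hdisj' : Pairwise (Function.onFun Disjoint fun i => f i '' A i)) :
    IsAlgebraic ℚ (volume D₀).toReal := by
  classical
  choose m c S hS hAS using fun i => soloInformed_isSemialgebraic_real_iff_fibre.1 (hA i)
  choose m' c' S' hS' hfS' using fun i => soloInformed_exists_fibre_of_isSemialgebraic_sum (hf i)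
  have hSσ : ∀ i, IsSemialgebraic ℚ ((soloInformedTameMapShapeOf m m' S S').S i) :=
    soloInformedTameMapShapeOf_isSemialgebraic_S S S' hS
  have hGσ : ∀ i, IsSemialgebraic ℚ ((soloInformedTameMapShapeOf m m' S S').G i) :=
    soloInformedTameMapShapeOf_isSemialgebraic_G S S' hS'
  have hpiece : ∀ i, (soloInformedTameMapShapeOf m m' S S').piece i
      (soloInformedTameMapParam m m' c c' a) = A i := fun i => by
    rw [soloInformedTameMapShapeOf_piece, ← hAS i]
  have hrel : ∀ i x y, (soloInformedTameMapShapeOf m m' S S').rel i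
      (soloInformedTameMapParam m m' c c' a) x y ↔ x ∈ A i ∧ f i x = y := fun i x y => by
    rw [soloInformedTameMapShapeOf_rel, ← hfS' i]
    simp only [mem_setOf_eq, Sum.elim_comp_inl, Sum.elim_comp_inr]
  have hside : (soloInformedTameMapShapeOf m m' S S').side
      (soloInformedTameMapParam m m' c c' a) = a := soloInformedTameMapShapeOf_side S S' c c' a
  have hB : (soloInformedTameMapShapeOf m m' S S').BasicValid D₀
      (soloInformedTameMapParam m m' c c' a) := by
    refine (soloInformedTameMapShapeOf m m' S S').basicValid_iff.2
      ⟨fun j => ?_, fun x => ⟨?_, ?_⟩, ?_, ?_, ?_, ?_, ?_⟩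
    · rw [hside]
      exact ha j
    · simp only [hpiece]
      rw [← hcover, mem_iUnion]
    · intro i i' hii' hxi hxi'
      rw [hpiece] at hxi hxi'
      exact Set.disjoint_left.1 (hdisj hii') hxi hxi'
    · intro i x hx
      rw [hpiece] at hx
      exact ⟨f i x, (hrel i x _).2 ⟨hx, rfl⟩⟩
    · intro i x y y' _ hy hy'
      rw [hrel] at hy hy'
      rw [← hy.2, ← hy'.2]
    · intro i x y hx hy
      rw [hrel] at hy
      rw [hpiece] at hx
      rw [hside]
      show y ∈ Set.pi Set.univ fun j => Set.Icc 0 (a j)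
      rw [← hcover', mem_iUnion]
      exact ⟨i, x, hx, hy.2⟩
    · intro y hy
      rw [hside] at hy
      change y ∈ Set.pi Set.univ (fun j => Set.Icc 0 (a j)) at hy
      rw [← hcover', mem_iUnion] at hy
      obtain ⟨i, x, hx, hxy⟩ := hy
      refine ⟨x, i, ?_, (hrel i x y).2 ⟨hx, hxy⟩⟩
      rw [hpiece]
      exact hx
    · intro i i' x x' y _ _ hy hy'
      rw [hrel] at hy hy'
      have hii' : i = i' := by
        by_contra hne
        exact Set.disjoint_left.1 (hdisj' hne) ⟨x, hy.1, hy.2⟩ ⟨x', hy'.1, hy'.2⟩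
      subst hii'
      exact ⟨rfl, hinj i hy.1 hy'.1 (hy.2.trans hy'.2.symm)⟩
  have hD : ∀ i, (soloInformedTameMapShapeOf m m' S S').DiffOK i
      (soloInformedTameMapParam m m' c c' a) := by
    intro i
    refine (soloInformedTameMapShapeOf m m' S S').diffOK_iff.2 fun x hx => ?_
    rw [hpiece] at hx
    refine ⟨soloInformedCLMEntry (f' i x), ?_, fun e he => ?_⟩
    · rw [soloInformed_det_of_clmEntry]
      exact hdet i x hx
    · obtain ⟨d, hd, hT⟩ := soloInformed_taylor_clmEntry (hf' i x hx) he
      refine ⟨d, hd, fun x' y y' hx' hcl hy hy' j => ?_⟩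
      rw [hpiece] at hx'
      rw [hrel] at hy hy'
      rw [← hy.2, ← hy'.2]
      exact hT x' hx' hcl j
  exact (soloInformed_realParameter_barrier_core_fintype
    ((soloInformedTameMapShapeOf m m' S S').isSemialgebraic_setOf_valid hSσ hGσ hD₀)
    (∏ j, (soloInformedTameMapShapeOf m m' S S').Pa j)
    (fun p hp => (soloInformedTameMapShapeOf m m' S S').aeval_prod_side_eq_volume_of_valid hSσ
      hp)).2 ⟨_, And.intro hB hD⟩

/-- **COROLLARY SQ, nonlinear form (no tame nonlinear circle squaring).** The closed unit disc is
not dissectable — finitely many `ℝ`-semialgebraic pieces of any dimensions, exact partitions,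
pieces moved by injective maps with `ℝ`-semialgebraic graphs having within-piece derivatives of
determinant `±1` (isometries, equi-affine maps, area-preserving polynomial shears, …) — onto any
box, in particular not onto the square of side `√π`. [cite: Lindemann1882] -/
theorem soloInformed_no_tame_circle_squaring_nonlinear {N : ℕ} {A : Fin N → Set (Fin 2 → ℝ)}
    (hA : ∀ i, IsSemialgebraic ℝ (A i)) (f : Fin N → (Fin 2 → ℝ) → Fin 2 → ℝ)
    (hf : ∀ i, IsSemialgebraic ℝ
      {v : Fin 2 ⊕ Fin 2 → ℝ | v ∘ Sum.inl ∈ A i ∧ f i (v ∘ Sum.inl) = v ∘ Sum.inr})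
    (hinj : ∀ i, InjOn (f i) (A i)) {f' : Fin N → (Fin 2 → ℝ) → (Fin 2 → ℝ) →L[ℝ] (Fin 2 → ℝ)}
    (hf' : ∀ i, ∀ x ∈ A i, HasFDerivWithinAt (f i) (f' i x) (A i) x)
    (hdet : ∀ i, ∀ x ∈ A i, (f' i x).det ^ 2 = 1) {a : Fin 2 → ℝ} (ha : ∀ j, 0 ≤ a j)
    (hcover : ⋃ i, A i = KZ.piDisc) (hdisj : Pairwise (Function.onFun Disjoint A))
    (hcover' : ⋃ i, f i '' A i = Set.pi Set.univ fun j => Set.Icc 0 (a j))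
    (hdisj' : Pairwise (Function.onFun Disjoint fun i => f i '' A i)) : False := by
  have h := soloInformed_isAlgebraic_volume_of_tameMapEquidecomp KZ.isSemialgebraic_piDisc hA f hf
    hinj hf' hdet ha hcover hdisj hcover' hdisj'
  rw [KZ.volume_piDisc, ENNReal.toReal_ofReal Real.pi_pos.le] at h
  exact transcendental_pi_holds h

/-- **COROLLARY (sources of transcendental volume admit no nonlinear tame dissection onto a
box).** [cite: BochnakCosteRoy1998, §5.2] -/
theorem soloInformed_no_tameMapEquidecomp_of_transcendental_volume {n N : ℕ}
    {D₀ : Set (Fin n → ℝ)} (hD₀ : IsSemialgebraic ℚ D₀) (hτ : Transcendental ℚ (volume D₀).toReal)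
    {A : Fin N → Set (Fin n → ℝ)} (hA : ∀ i, IsSemialgebraic ℝ (A i))
    (f : Fin N → (Fin n → ℝ) → Fin n → ℝ)
    (hf : ∀ i, IsSemialgebraic ℝ
      {v : Fin n ⊕ Fin n → ℝ | v ∘ Sum.inl ∈ A i ∧ f i (v ∘ Sum.inl) = v ∘ Sum.inr})
    (hinj : ∀ i, InjOn (f i) (A i)) {f' : Fin N → (Fin n → ℝ) → (Fin n → ℝ) →L[ℝ] (Fin n → ℝ)}
    (hf' : ∀ i, ∀ x ∈ A i, HasFDerivWithinAt (f i) (f' i x) (A i) x)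
    (hdet : ∀ i, ∀ x ∈ A i, (f' i x).det ^ 2 = 1) {a : Fin n → ℝ} (ha : ∀ j, 0 ≤ a j)
    (hcover : ⋃ i, A i = D₀) (hdisj : Pairwise (Function.onFun Disjoint A))
    (hcover' : ⋃ i, f i '' A i = Set.pi Set.univ fun j => Set.Icc 0 (a j))
    (hdisj' : Pairwise (Function.onFun Disjoint fun i => f i '' A i)) : False :=
  hτ (soloInformed_isAlgebraic_volume_of_tameMapEquidecomp hD₀ hA f hf hinj hf' hdet ha hcover
    hdisj hcover' hdisj')

end Summit.KontsevichZagierPeriods.KontsevichZagierPeriods.Theorems
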